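import Mathlib
import Literature.RingTheory.CohomologyAnnihilator.Basic
import Literature.RingTheory.CohomologyAnnihilator.Localization
import Summits.ResolutionOfSingularities.ResolutionOfSingularities.Theorems.HomologicalConductorPersistenceVeroneseExponentTwo
import HarnessLib

/-!
# Exponent two at level four on the `1/5(1,3)` cylinder: `(𝔪_V R)² ⊆ ca⁴(R)` in every characteristic

Crux `HomologicalConductor.Persistence` (stmt-ResolutionOfSingularities-16484), chain W4.4b, rung L1;
companion of `Theorems/HomologicalConductorPersistenceVeroneseExponentTwo.lean` (stub-3, ASSIGN v0.9 row
(1)) at the SECOND computed tower-stage type of the chain: the normalised `ca`-chart of the `A₄ × line`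
tower is `(V'[u])_Q` with `V' = k[a,b]^{1/5(1,3)} = k[a⁵, a²b, ab³, b⁵]` (idea-1 card A4, logs S5–S8;
N11's specimen `a²b`). `[OURS · L1 w44b]` — our own by-product about ONE stage type of the route's
`ca`-tower; NOT a statement of the manuscript under review and using none of its statements; AI-written
(weaker than expert review).

## Statement

`R := k[a,b,u]^{(1,3,0) mod 5}`, the subalgebra of `MvPolynomial (Fin 3) k` (`a = X 0`, `b = X 1`,
`u = X 2`) of polynomials of weighted degree `0` for `![1, 3, 0] : Fin 3 → ZMod 5`; equivalently
(`mem_adjoin_fiveThree_iff`) `Algebra.adjoin k {a⁵, a²b, ab³, b⁵, u}`. With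
`𝔪_V R := (a⁵, a²b, ab³, b⁵) R` (the ideal of the singular line):

* `fiveThree_sq_le_cohomologyAnnihilatorOfDegree_four` : `(𝔪_V R)² ≤ ca⁴(R)`, `k` ANY field;
* `fiveThree_adjoin_sq_le_cohomologyAnnihilatorOfDegree_four` : the same for `Algebra.adjoin k {…}`;
* `fiveThree_sq_map_le_cohomologyAnnihilatorOfDegree_four` : `(𝔪_V L)² ≤ ca⁴(L)` at every
  localisation `L` (in particular the tower stage `(V'[u])_Q`).

So at this stage too `ca ⊇ 𝔪_V²`: whatever is LOST there (N11: `a²b ∉ ca⁶` on machine evidence) is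
lost only modulo `𝔪_V²` — KEPT/LOST is a question about individual minimal generators.

## Proof

`graded_span_pow_le_cohomologyAnnihilatorOfDegree` (the general finite-abelian-grading form, same
chain, p503054) with `e = 1`, `M = ℤ/5`, `w = (1,3,0)`: every one of the four generators SPLITS IN EVERY
DEGREE `g ∈ ℤ/5` (`exists_split_of_mem_fiveThree`: its sub-monomials realise every residue — e.g.
`a²b ⊇ {1, a, a², b, ab}` of degrees `0,1,2,3,4`), and `k[a⁵, a²b, ab³, b⁵, u]` is the degree-`0` part
(`mem_adjoin_fiveThree_iff`, `X_pow_mul_X_pow_mem_adjoin_fiveThree`: the semigroup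
`{(i,j) : 5 ∣ i + 3j}` is generated by `(5,0), (2,1), (1,3), (0,5)`). Contrast (same criterion, by
hand): at `1/7(1,3)` the generator `ab²` does NOT split in degrees `2, 5`, and at `1/8(1,5)` neither
`a³b` nor `ab³` splits in degree `4` — exactly the monomials of tri-1's cycle rule CR predictions.
-/

-- single-problem summit: the doubled namespace component is forced
set_option linter.dupNamespace false

noncomputable section

open CategoryTheory CategoryTheory.Abelian

universe u

namespace Summit.ResolutionOfSingularities.ResolutionOfSingularities.Theorems.HomologicalConductor.PersistenceQuotientFiveThreeExponentTwo

open MvPolynomial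
open Literature.RingTheory.CohomologyAnnihilator
open Summit.ResolutionOfSingularities.ResolutionOfSingularities.Theorems.HomologicalConductor.PersistenceVeroneseExponentTwo

variable (k : Type u)

/-- `5 ∣ i + 3j` implies `aⁱ bʲ ∈ k[a⁵, a²b, ab³, b⁵, u]`: the semigroup of invariant exponents of
`1/5(1,3)` is generated by `(5,0), (2,1), (1,3), (0,5)`. [folklore] -/
theorem X_pow_mul_X_pow_mem_adjoin_fiveThree [CommRing k] (i j : ℕ) (h : 5 ∣ i + 3 * j) :
    (X 0 ^ i * X 1 ^ j : MvPolynomial (Fin 3) k) ∈ Algebra.adjoin k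
      ({X 0 ^ 5, X 0 ^ 2 * X 1, X 0 * X 1 ^ 3, X 1 ^ 5, X 2} : Set (MvPolynomial (Fin 3) k)) := by
  set A := Algebra.adjoin k
      ({X 0 ^ 5, X 0 ^ 2 * X 1, X 0 * X 1 ^ 3, X 1 ^ 5, X 2} : Set (MvPolynomial (Fin 3) k)) with hA
  have h0 : (X 0 ^ 5 : MvPolynomial (Fin 3) k) ∈ A := Algebra.subset_adjoin (by simp)
  have h1 : (X 1 ^ 5 : MvPolynomial (Fin 3) k) ∈ A := Algebra.subset_adjoin (by simp)
  have h21 : (X 0 ^ 2 * X 1 : MvPolynomial (Fin 3) k) ∈ A := Algebra.subset_adjoin (by simp)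
  have h13 : (X 0 * X 1 ^ 3 : MvPolynomial (Fin 3) k) ∈ A := Algebra.subset_adjoin (by simp)
  obtain ⟨qi, ri, hri, rfl⟩ : ∃ q r, r < 5 ∧ i = 5 * q + r :=
    ⟨i / 5, i % 5, Nat.mod_lt _ (by norm_num), (Nat.div_add_mod i 5).symm⟩
  obtain ⟨qj, rj, hrj, rfl⟩ : ∃ q r, r < 5 ∧ j = 5 * q + r :=
    ⟨j / 5, j % 5, Nat.mod_lt _ (by norm_num), (Nat.div_add_mod j 5).symm⟩
  have key : (X 0 ^ ri * X 1 ^ rj : MvPolynomial (Fin 3) k) ∈ A := by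
    obtain ⟨t, ht⟩ := h
    have hmod : (ri + 3 * rj) % 5 = 0 := by omega
    have e42 : (X 0 ^ 4 * X 1 ^ 2 : MvPolynomial (Fin 3) k) = (X 0 ^ 2 * X 1) ^ 2 := by ring
    have e34 : (X 0 ^ 3 * X 1 ^ 4 : MvPolynomial (Fin 3) k) = (X 0 ^ 2 * X 1) * (X 0 * X 1 ^ 3) := by
      ring
    interval_cases ri <;> interval_cases rj <;> try (exfalso; omega)
    -- the five invariant residues `(ri, rj) = (0,0), (1,3), (2,1), (3,4), (4,2)`
    · simp
    · simpa using h13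
    · simpa using h21
    · rw [e34]
      exact A.mul_mem h21 h13
    · rw [e42]
      exact A.pow_mem h21 2
  rw [pow_add, pow_add, pow_mul, pow_mul, mul_mul_mul_comm]
  exact A.mul_mem (A.mul_mem (A.pow_mem h0 _) (A.pow_mem h1 _)) key

/-- Monomials `aⁱ bʲ` are weighted homogeneous of degree `i + 3j (mod 5)` for the weights `(1,3,0)`.
[folklore] -/
theorem isWeightedHomogeneous_monomial_fiveThree [CommRing k] (i j : ℕ) (m : ZMod 5)
    (hm : (i : ZMod 5) + 3 * j = m) :
    IsWeightedHomogeneous (![1, 3, 0] : Fin 3 → ZMod 5) (X 0 ^ i * X 1 ^ j : MvPolynomial (Fin 3) k) m := by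
  have ha : IsWeightedHomogeneous (![1, 3, 0] : Fin 3 → ZMod 5) (X 0 : MvPolynomial (Fin 3) k) 1 :=
    isWeightedHomogeneous_X k _ 0
  have hb : IsWeightedHomogeneous (![1, 3, 0] : Fin 3 → ZMod 5) (X 1 : MvPolynomial (Fin 3) k) 3 :=
    isWeightedHomogeneous_X k _ 1
  refine isWeightedHomogeneous_of_eq k _ ((ha.pow i).mul (hb.pow j)) ?_
  rw [← hm, nsmul_eq_mul, nsmul_eq_mul, mul_one, mul_comm]

/-- **`k[a⁵, a²b, ab³, b⁵, u]` is the degree-zero part** of `k[a,b,u]` for the weights `(1,3,0)` with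
values in `ℤ/5`. [folklore] -/
theorem mem_adjoin_fiveThree_iff [CommRing k] (p : MvPolynomial (Fin 3) k) :
    p ∈ Algebra.adjoin k
        ({X 0 ^ 5, X 0 ^ 2 * X 1, X 0 * X 1 ^ 3, X 1 ^ 5, X 2} : Set (MvPolynomial (Fin 3) k)) ↔
      IsWeightedHomogeneous (![1, 3, 0] : Fin 3 → ZMod 5) p 0 := by
  set w : Fin 3 → ZMod 5 := ![1, 3, 0] with hw
  have hu : IsWeightedHomogeneous w (X 2 : MvPolynomial (Fin 3) k) 0 := isWeightedHomogeneous_X k w 2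
  constructor
  · intro hp
    induction hp using Algebra.adjoin_induction with
    | mem x hx =>
      simp only [Set.mem_insert_iff, Set.mem_singleton_iff] at hx
      rcases hx with rfl | rfl | rfl | rfl | rfl
      · simpa using isWeightedHomogeneous_monomial_fiveThree k 5 0 0 (by decide)
      · simpa using isWeightedHomogeneous_monomial_fiveThree k 2 1 0 (by decide)
      · simpa using isWeightedHomogeneous_monomial_fiveThree k 1 3 0 (by decide)
      · simpa using isWeightedHomogeneous_monomial_fiveThree k 0 5 0 (by decide)
      · exact hu
    | algebraMap r => exact isWeightedHomogeneous_C w r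
    | add x y _ _ hx hy => exact hx.add hy
    | mul x y _ _ hx hy => exact isWeightedHomogeneous_of_eq k w (hx.mul hy) (add_zero 0)
  · intro hp
    rw [p.as_sum]
    refine Subalgebra.sum_mem _ fun d hd => ?_
    have hwd : Finsupp.weight w d = 0 := hp (mem_support_iff.mp hd)
    have h5 : 5 ∣ d 0 + 3 * d 1 := by
      rw [Finsupp.weight_apply, Finsupp.sum_fintype d (fun i c => c • w i) (fun i => zero_smul ℕ (w i)),
        Fin.sum_univ_three] at hwd
      have h01 : ((d 0 + 3 * d 1 : ℕ) : ZMod 5) = 0 := by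
        simp only [hw, Matrix.cons_val_zero, Matrix.cons_val_one, Matrix.cons_val, nsmul_eq_mul,
          mul_one, mul_zero, add_zero] at hwd
        push_cast
        linear_combination hwd
      exact (ZMod.natCast_eq_zero_iff _ _).mp h01
    rw [monomial_eq, Finsupp.prod_fintype _ _ (fun _ => pow_zero _), Fin.prod_univ_three]
    refine Subalgebra.mul_mem _ (Subalgebra.algebraMap_mem _ _) ?_
    exact Subalgebra.mul_mem _ (X_pow_mul_X_pow_mem_adjoin_fiveThree k (d 0) (d 1) h5)
      (Subalgebra.pow_mem _ (Algebra.subset_adjoin (by simp)) _)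

/-- **Every generator of `𝔪_V`, `V = 1/5(1,3)`, splits in every degree**: for `c ∈ {a⁵, a²b, ab³, b⁵}`
and every `g ∈ ℤ/5` there are monomials `x, y` of degrees `-g, g` with `y x = c` (the sub-monomials
of each generator realise every residue class mod `5`). [folklore] -/
theorem exists_split_of_mem_fiveThree [CommRing k] (c : MvPolynomial (Fin 3) k)
    (hc : c ∈ ({X 0 ^ 5, X 0 ^ 2 * X 1, X 0 * X 1 ^ 3, X 1 ^ 5} : Set (MvPolynomial (Fin 3) k)))
    (g : ZMod 5) :
    ∃ x y : MvPolynomial (Fin 3) k,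
      IsWeightedHomogeneous (![1, 3, 0] : Fin 3 → ZMod 5) x (-g) ∧
      IsWeightedHomogeneous (![1, 3, 0] : Fin 3 → ZMod 5) y g ∧ y * x = c := by
  have m := isWeightedHomogeneous_monomial_fiveThree k
  simp only [Set.mem_insert_iff, Set.mem_singleton_iff] at hc
  rcases hc with rfl | rfl | rfl | rfl <;> fin_cases g
  -- `a⁵`: `y = aᵍ`, `x = a⁵⁻ᵍ`
  · exact ⟨X 0 ^ 5 * X 1 ^ 0, X 0 ^ 0 * X 1 ^ 0, m 5 0 _ (by decide), m 0 0 _ (by decide), by ring⟩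
  · exact ⟨X 0 ^ 4 * X 1 ^ 0, X 0 ^ 1 * X 1 ^ 0, m 4 0 _ (by decide), m 1 0 _ (by decide), by ring⟩
  · exact ⟨X 0 ^ 3 * X 1 ^ 0, X 0 ^ 2 * X 1 ^ 0, m 3 0 _ (by decide), m 2 0 _ (by decide), by ring⟩
  · exact ⟨X 0 ^ 2 * X 1 ^ 0, X 0 ^ 3 * X 1 ^ 0, m 2 0 _ (by decide), m 3 0 _ (by decide), by ring⟩
  · exact ⟨X 0 ^ 1 * X 1 ^ 0, X 0 ^ 4 * X 1 ^ 0, m 1 0 _ (by decide), m 4 0 _ (by decide), by ring⟩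
  -- `a²b`: sub-monomials `1, a, a², b, ab` of degrees `0, 1, 2, 3, 4`
  · exact ⟨X 0 ^ 2 * X 1 ^ 1, X 0 ^ 0 * X 1 ^ 0, m 2 1 _ (by decide), m 0 0 _ (by decide), by ring⟩
  · exact ⟨X 0 ^ 1 * X 1 ^ 1, X 0 ^ 1 * X 1 ^ 0, m 1 1 _ (by decide), m 1 0 _ (by decide), by ring⟩
  · exact ⟨X 0 ^ 0 * X 1 ^ 1, X 0 ^ 2 * X 1 ^ 0, m 0 1 _ (by decide), m 2 0 _ (by decide), by ring⟩
  · exact ⟨X 0 ^ 2 * X 1 ^ 0, X 0 ^ 0 * X 1 ^ 1, m 2 0 _ (by decide), m 0 1 _ (by decide), by ring⟩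
  · exact ⟨X 0 ^ 1 * X 1 ^ 0, X 0 ^ 1 * X 1 ^ 1, m 1 0 _ (by decide), m 1 1 _ (by decide), by ring⟩
  -- `ab³`: sub-monomials `1, a, ab², b, ab` of degrees `0, 1, 2, 3, 4`
  · exact ⟨X 0 ^ 1 * X 1 ^ 3, X 0 ^ 0 * X 1 ^ 0, m 1 3 _ (by decide), m 0 0 _ (by decide), by ring⟩
  · exact ⟨X 0 ^ 0 * X 1 ^ 3, X 0 ^ 1 * X 1 ^ 0, m 0 3 _ (by decide), m 1 0 _ (by decide), by ring⟩
  · exact ⟨X 0 ^ 0 * X 1 ^ 1, X 0 ^ 1 * X 1 ^ 2, m 0 1 _ (by decide), m 1 2 _ (by decide), by ring⟩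
  · exact ⟨X 0 ^ 1 * X 1 ^ 2, X 0 ^ 0 * X 1 ^ 1, m 1 2 _ (by decide), m 0 1 _ (by decide), by ring⟩
  · exact ⟨X 0 ^ 0 * X 1 ^ 2, X 0 ^ 1 * X 1 ^ 1, m 0 2 _ (by decide), m 1 1 _ (by decide), by ring⟩
  -- `b⁵`: sub-monomials `1, b², b⁴, b, b³` of degrees `0, 1, 2, 3, 4`
  · exact ⟨X 0 ^ 0 * X 1 ^ 5, X 0 ^ 0 * X 1 ^ 0, m 0 5 _ (by decide), m 0 0 _ (by decide), by ring⟩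
  · exact ⟨X 0 ^ 0 * X 1 ^ 3, X 0 ^ 0 * X 1 ^ 2, m 0 3 _ (by decide), m 0 2 _ (by decide), by ring⟩
  · exact ⟨X 0 ^ 0 * X 1 ^ 1, X 0 ^ 0 * X 1 ^ 4, m 0 1 _ (by decide), m 0 4 _ (by decide), by ring⟩
  · exact ⟨X 0 ^ 0 * X 1 ^ 4, X 0 ^ 0 * X 1 ^ 1, m 0 4 _ (by decide), m 0 1 _ (by decide), by ring⟩
  · exact ⟨X 0 ^ 0 * X 1 ^ 2, X 0 ^ 0 * X 1 ^ 3, m 0 2 _ (by decide), m 0 3 _ (by decide), by ring⟩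

/-- **Exponent two at level four on the `1/5(1,3)` cylinder, degree-zero form (all characteristics):**
for `R = k[a,b,u]^{(1,3,0) mod 5} = V'[u]`, `V' = k[a⁵, a²b, ab³, b⁵]`, the singular-line ideal
`𝔪_V R = (a⁵, a²b, ab³, b⁵) R` satisfies `(𝔪_V R)² ⊆ ca⁴(R)`. [OURS · L1 w44b; folklore method] -/
theorem fiveThree_sq_le_cohomologyAnnihilatorOfDegree_four [Field k]
    (R : Subalgebra k (MvPolynomial (Fin 3) k))
    (hR : ∀ p, p ∈ R ↔ IsWeightedHomogeneous (![1, 3, 0] : Fin 3 → ZMod 5) p 0) :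
    Ideal.span (((↑) : R → MvPolynomial (Fin 3) k) ⁻¹'
        {X 0 ^ 5, X 0 ^ 2 * X 1, X 0 * X 1 ^ 3, X 1 ^ 5}) ^ 2 ≤
      cohomologyAnnihilatorOfDegree R 4 := by
  have hR' : R = Algebra.adjoin k
      ({X 0 ^ 5, X 0 ^ 2 * X 1, X 0 * X 1 ^ 3, X 1 ^ 5, X 2} : Set (MvPolynomial (Fin 3) k)) := by
    ext p
    rw [hR, mem_adjoin_fiveThree_iff]
  haveI : Algebra.FiniteType k R := by
    rw [← Subalgebra.fg_iff_finiteType, Subalgebra.fg_def]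
    exact ⟨_, ((((Set.finite_singleton _).insert _).insert _).insert _).insert _, hR'.symm⟩
  haveI : IsNoetherianRing R := Algebra.FiniteType.isNoetherianRing k R
  exact graded_span_pow_le_cohomologyAnnihilatorOfDegree k (e := 1) (![1, 3, 0] : Fin 3 → ZMod 5) R hR
    _ (fun c hc => exists_split_of_mem_fiveThree k (c : MvPolynomial (Fin 3) k) hc)

/-- The same for the named subalgebra `k[a⁵, a²b, ab³, b⁵, u] = Algebra.adjoin k {…}`.
[OURS · L1 w44b] -/
theorem fiveThree_adjoin_sq_le_cohomologyAnnihilatorOfDegree_four [Field k] :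
    Ideal.span (((↑) : ↥(Algebra.adjoin k ({X 0 ^ 5, X 0 ^ 2 * X 1, X 0 * X 1 ^ 3, X 1 ^ 5, X 2} :
        Set (MvPolynomial (Fin 3) k))) → MvPolynomial (Fin 3) k) ⁻¹'
        {X 0 ^ 5, X 0 ^ 2 * X 1, X 0 * X 1 ^ 3, X 1 ^ 5}) ^ 2 ≤
      cohomologyAnnihilatorOfDegree ↥(Algebra.adjoin k ({X 0 ^ 5, X 0 ^ 2 * X 1, X 0 * X 1 ^ 3,
        X 1 ^ 5, X 2} : Set (MvPolynomial (Fin 3) k))) 4 :=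
  fiveThree_sq_le_cohomologyAnnihilatorOfDegree_four k _ (mem_adjoin_fiveThree_iff k)

/-- **At the tower stage `(V'[u])_Q`** (and any localisation `L` of `R`): `(𝔪_V L)² ⊆ ca⁴(L)`
([IyengarTakahashi2014, Lemma 2.10(1)]). [OURS · L1 w44b] -/
theorem fiveThree_sq_map_le_cohomologyAnnihilatorOfDegree_four [Field k]
    (R : Subalgebra k (MvPolynomial (Fin 3) k))
    (hR : ∀ p, p ∈ R ↔ IsWeightedHomogeneous (![1, 3, 0] : Fin 3 → ZMod 5) p 0)
    (U : Submonoid R) (L : Type u) [CommRing L] [Algebra R L] [IsLocalization U L] :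
    (Ideal.span (((↑) : R → MvPolynomial (Fin 3) k) ⁻¹'
        {X 0 ^ 5, X 0 ^ 2 * X 1, X 0 * X 1 ^ 3, X 1 ^ 5})).map (algebraMap R L) ^ 2 ≤
      cohomologyAnnihilatorOfDegree L 4 := by
  have hR' : R = Algebra.adjoin k
      ({X 0 ^ 5, X 0 ^ 2 * X 1, X 0 * X 1 ^ 3, X 1 ^ 5, X 2} : Set (MvPolynomial (Fin 3) k)) := by
    ext p
    rw [hR, mem_adjoin_fiveThree_iff]
  haveI : Algebra.FiniteType k R := by
    rw [← Subalgebra.fg_iff_finiteType, Subalgebra.fg_def]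
    exact ⟨_, ((((Set.finite_singleton _).insert _).insert _).insert _).insert _, hR'.symm⟩
  haveI : IsNoetherianRing R := Algebra.FiniteType.isNoetherianRing k R
  rw [← Ideal.map_pow]
  exact (Ideal.map_mono (fiveThree_sq_le_cohomologyAnnihilatorOfDegree_four k R hR)).trans
    (map_cohomologyAnnihilatorOfDegree_le_of_isLocalization U L 4)

end Summit.ResolutionOfSingularities.ResolutionOfSingularities.Theorems.HomologicalConductor.PersistenceQuotientFiveThreeExponentTwo

end
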